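import Summits.BirchSwinnertonDyer.BirchSwinnertonDyer.Theorems.CyclotomicUntwistWildThreeTameTorsionCellLaw
import Summits.BirchSwinnertonDyer.BirchSwinnertonDyer.Theorems.KatoDescentPotSupersingularWildUpperReducibleNineTorsionLocal
import Literature.NumberTheory.EllipticCurves.NonEisensteinPrimeOfSurjective
import Literature.NumberTheory.EllipticCurves.AnomalousOfRationalTorsionProofs
import HarnessLib

/-!
# Rational torsion on the wild cell at `3`: `c₃ ∈ {1, 3}`, `#W(ℚ)_tors ∣ 9`, and
# `#W(ℚ)_tors = 1` whenever `W[3]` is irreducible — in particular on EVERY K1/K2/X3 row (`ρ̄₃` onto)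

Cell `pub/bsd-wall` (D-0145 line `route-BirchSwinnertonDyer-CyclotomicUntwist`), seat `bsd-line-cycu-p2`
(prover seat 2/3, gen 4); helper toward K1 `PSRankOneLowerHalfAtThree` (stmt-BirchSwinnertonDyer-21580) and
K2 `PSRankOneUpperHalfAtThree` (stmt-21581). THEOREMS ONLY (no definition, no named fact, no `sorry`); BSD is
not proved by this file and no crux is. It makes cycu-p3 g5's K1-ROW-ATLAS column «`#E(ℚ)_tors = 1` on all
416 rows (N < 5·10⁵)» a THEOREM on the whole leaf: the torsion term of the BSD quotient is `1` on every
K1/K2 row (and on the supercuspidal residual X3), not just `3`-adically trivial.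

* `localTamagawaNumber_three_of_classO6` — on the wild cell (`ClassO6 W 3`: Kodaira `II/IV/IV*/II*` at `3`)
  `c₃ ∈ {1, 3}` for EVERY parity of `v₃Δ_min` (even rows: `PSKodairaDictionary.localTamagawaNumber_three_of_even`;
  odd rows: the same tree facts, Tate's algorithm Steps 3/5/8/10, through `kodairaSymbolAt_windows`).
* `torsionOrder_dvd_nine_of_classO6` — `#W(ℚ)_tors ∣ 9`: the K9 seat's route-free
  `torsionOrder_dvd_three_mul_localTamagawaNumber_of_addv_three` (`#E(ℚ)_tors ∣ 3·c₃` at an additive `3`: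
  `E(ℚ)_tors ↪ E(ℚ₃)/E₁(ℚ₃)`, a group of order `c₃ · #Ẽ_ns(𝔽₃) = 3c₃`) with `c₃ ∣ 3`. So NO prime-to-`3`
  rational torsion on the wild cell (no rational `2`-torsion, hence no rational `2`-isogeny either).
* `torsionOrder_eq_one_of_classO6_of_irreducible` — with `W[3]` irreducible (`3 ∤ #W(ℚ)_tors`,
  `not_hasIrreducibleModPGaloisRep_of_dvd_torsionOrder`): **`#W(ℚ)_tors = 1`**; `…_of_surj` (`ρ̄₃` onto ⟹
  irreducible, `hasIrreducibleModPGaloisRep_of_hasSurjectiveModNGaloisRep`); `psRows_torsionOrder_eq_one` in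
  the K1/K2 binder shape.
References: J. H. Silverman, *AEC* (2009) VII.2.1, VII.3.1, VII.6.1 [SilvermanAEC2009]; *ATAEC* (1994) IV.9.4
Steps 3, 5, 8, 10 [SilvermanATAEC1994]; J.-P. Serre, Invent. Math. 15 (1972) §4 [Serre1972].
-/

set_option autoImplicit false
-- single-conjunct summit: `Summit.BirchSwinnertonDyer.BirchSwinnertonDyer.…` repeats the name by design
set_option linter.dupNamespace false

noncomputable section

open scoped Classical

open WeierstrassCurve IsDedekindDomain Rat.HeightOneSpectrum Literature.NumberTheory.EllipticCurves
  Literature.NumberTheory.EllipticCurves.Rank1Residual Literature.NumberTheory.DiophantineGeometry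
  Summit.BirchSwinnertonDyer.Rank1Residual.Additive
  Summit.BirchSwinnertonDyer.BirchSwinnertonDyer.Theorems.WildUpperReducibleNineTorsionLocal

namespace Summit.BirchSwinnertonDyer.BirchSwinnertonDyer.Theorems.PSLocalThreeTorsion

section Torsion

variable (W : WeierstrassCurve ℚ) [W.IsElliptic] [W.IsGloballyMinimal]

/-- **`c₃ ∈ {1, 3}` on the whole wild cell** (`ClassO6 W 3`; Kodaira `II`, `II*`: `c₃ = 1`; `IV`, `IV*`:
`c₃ ∈ {1, 3}`), for either parity of `v₃Δ_min`. [cite: SilvermanATAEC1994, IV.9.4 Steps 3, 5, 8, 10 (PDF pp. 344–346)] -/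
theorem localTamagawaNumber_three_of_classO6 (hO6 : ClassO6 W 3) :
    (W.baseChange ℚ_[3]).localTamagawaNumber ℤ_[3] = 1 ∨
      (W.baseChange ℚ_[3]).localTamagawaNumber ℤ_[3] = 3 := by
  haveI : PerfectField (IsLocalRing.ResidueField ((placeOf 3).adicCompletionIntegers ℚ)) :=
    PerfectField.ofFinite
  rcases PSKodairaDictionary.kodairaSymbolAt_windows W hO6.2.1 hO6.2.2 with
    ⟨hK, -⟩ | ⟨hK, -⟩ | ⟨hK, -⟩ | ⟨hK, -⟩
  · left
    rw [localTamagawaNumber_padic_eq_placeOf W 3]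
    exact localTamagawaNumber_eq_one_of_kodairaSymbolAt_eq_II_holds (placeOf 3) W hK
  · exact localTamagawaNumber_padic_eq_one_or_three_of_hasKodairaIVOrIVstarAt W 3 (Or.inl hK)
  · exact localTamagawaNumber_padic_eq_one_or_three_of_hasKodairaIVOrIVstarAt W 3 (Or.inr hK)
  · left
    rw [localTamagawaNumber_padic_eq_placeOf W 3]
    exact localTamagawaNumber_eq_one_of_kodairaSymbolAt_eq_IIstar_holds (placeOf 3) W hK

/-- **`#W(ℚ)_tors ∣ 9` on the wild cell**: `#E(ℚ)_tors ∣ 3·c₃` at the additive prime `3`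
(`E(ℚ)_tors ↪ E(ℚ₃)/E₁(ℚ₃)`, of order `3c₃`) and `c₃ ∣ 3`. In particular no rational torsion of order
prime to `3` (no rational `2`-torsion point, no rational `2`-isogeny) on any O6 row.
[cite: SilvermanAEC2009, VII.2.1, VII.3.1 and VII.6.1] -/
theorem torsionOrder_dvd_nine_of_classO6 (hO6 : ClassO6 W 3) : W.torsionOrder ∣ 9 := by
  have h := torsionOrder_dvd_three_mul_localTamagawaNumber_of_addv_three W hO6.2.1
  rcases localTamagawaNumber_three_of_classO6 W hO6 with hc | hc <;> rw [hc] at h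
  · exact h.trans (by norm_num)
  · exact h

/-- No rational point of order prime to `3` on the wild cell: for a prime `ℓ ≠ 3`, `ℓ ∤ #W(ℚ)_tors`.
[cite: SilvermanAEC2009, VII.3.1 and VII.6.1] -/
theorem not_dvd_torsionOrder_of_classO6 (hO6 : ClassO6 W 3) {ℓ : ℕ} (hℓ : ℓ.Prime) (hℓ3 : ℓ ≠ 3) :
    ¬ ℓ ∣ W.torsionOrder := by
  intro h
  have h9 : ℓ ∣ 3 ^ 2 := h.trans (by simpa using torsionOrder_dvd_nine_of_classO6 W hO6)
  exact hℓ3 ((Nat.prime_dvd_prime_iff_eq hℓ Nat.prime_three).mp (hℓ.dvd_of_dvd_pow h9))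

/-- **`#W(ℚ)_tors = 1` on the wild cell whenever `W[3]` is an irreducible `Γ_ℚ`-module** (`3 ∤ #tors` by
irreducibility, `#tors ∣ 9` by the cell). [cite: SilvermanAEC2009, VII.3.1 and VII.6.1] [cite: Serre1972, §4] -/
theorem torsionOrder_eq_one_of_classO6_of_irreducible (hO6 : ClassO6 W 3)
    (hirr : W.HasIrreducibleModPGaloisRep 3) : W.torsionOrder = 1 := by
  have h9 := torsionOrder_dvd_nine_of_classO6 W hO6
  have h3 : ¬ 3 ∣ W.torsionOrder := fun h ↦ not_hasIrreducibleModPGaloisRep_of_dvd_torsionOrder W 3 h hirr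
  have hpos : 0 < W.torsionOrder := W.torsionOrder_pos_holds
  have hle : W.torsionOrder ≤ 9 := Nat.le_of_dvd (by norm_num) h9
  interval_cases hT : W.torsionOrder <;> simp_all

/-- **`#W(ℚ)_tors = 1` on the wild cell when `ρ̄_{W,3}` is onto** (onto ⟹ irreducible). Every K1/K2/X3 row of
route `CyclotomicUntwist` (and of the W-ALL leaf `WAllExclAddWildRankOneSurj`) carries `Surj W 3`.
[cite: Serre1972, §4] [cite: SilvermanAEC2009, VII.3.1 and VII.6.1] -/
theorem torsionOrder_eq_one_of_classO6_of_surj (hO6 : ClassO6 W 3) (hs : Surj W 3) :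
    W.torsionOrder = 1 :=
  torsionOrder_eq_one_of_classO6_of_irreducible W hO6
    (hasIrreducibleModPGaloisRep_of_hasSurjectiveModNGaloisRep W 3 hs)

omit W [W.IsElliptic] [W.IsGloballyMinimal] in
/-- In the binder shape of K1/K2 (`∀ W, ¬ CM → ClassO6 W 3 → Surj W 3 → v even → Δ′ ≡ 1 → r_an = 1 → …`; the
unused binders are kept so that a line can `have` this verbatim): **the torsion term of the BSD quotient is
`1` on every principal-series row.** [cite: SilvermanAEC2009, VII.3.1 and VII.6.1] -/
theorem psRows_torsionOrder_eq_one :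
    ∀ (W : WeierstrassCurve ℚ) [W.IsElliptic] [W.IsGloballyMinimal], ¬ W.HasCM → ClassO6 W 3 → Surj W 3 →
      Even (padicValInt 3 W.minimalDiscriminantInt) →
      W.minimalDiscriminantInt / 3 ^ padicValInt 3 W.minimalDiscriminantInt % 3 = 1 →
      W.analyticRank = 1 → W.torsionOrder = 1 :=
  fun W _ _ _ hO6 hs _ _ _ ↦ torsionOrder_eq_one_of_classO6_of_surj W hO6 hs

end Torsion

end Summit.BirchSwinnertonDyer.BirchSwinnertonDyer.Theorems.PSLocalThreeTorsion

end
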